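import Literature.AlgebraicGeometry.ProjectiveSpace.CoverIdealSymbolicPowers
import HarnessLib

/-!
# Weighted cover ideals of bipartite graphs: `(⋂_{u ∼ v} (x_u, x_v)^{w_{uv}})^{(k)} = (⋂ (x_u, x_v)^{w_{uv}})^k`
# (Herzog–Hibi–Trung, Theorem 5.4)

Topic `Literature/AlgebraicGeometry/ProjectiveSpace`, namespace
`Literature.AlgebraicGeometry.ProjectiveSpace`. Lane `lit-hodgefound`, seat `lit-hodgefound-p32`,
row gen31-#20. Theorems only (no `def`, no named fact). Generalises `CoverIdealSymbolicPowers`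
(gen31-#15, Theorem 5.1 (b) "if", the weight `w ≡ 1`) to arbitrary edge weights.

## The source, as printed

J. Herzog, T. Hibi, N. V. Trung, *Symbolic powers of monomial ideals and vertex cover algebras*, §4:
"We call `a ∈ ℕ^n` a vertex cover of `(Δ, w)` of order `k` if `∑_{i ∈ F} a(i) ≥ k w_F` for all `F`";
"`I*(Δ, w) := ⋂_{F ∈ F(Δ)} P_F^{w_F}`"; Lemma 4.1 (proof): "`u t^k` belongs to `A_k(Δ, w)` if and only
if `u ∈ ⋂_F P_F^{k w_F} = ⋂_F (P_F^{w_F})^k`." **Theorem 5.4.** "Let `G` be a finite bipartite graph on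
`[n]` and `w` an arbitrary weight function on `G`. Then the vertex cover algebra `A(G, w)` is a
standard graded `S`-algebra." Proof: "Suppose that `a + b ≥ k N`. We claim
`⌈a/k⌉ + ⌊b/k⌋ ≥ N` and `(a − ⌈a/k⌉) + (b − ⌊b/k⌋) ≥ (k − 1) N` … We then define `b` by setting
`b(i) = ⌈a(i)/k⌉` if `i ∈ U` and `b(j) = ⌊a(j)/k⌋` if `j ∈ V`. Let `c = a − b` … `x^b t ∈ A_1(G, w)`
and `x^c t^{k−1} ∈ A_{k−1}(G, w)`." And: "`A(Δ, w)` is standard graded over `S` if and only if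
`I*(Δ, w)^{(n)} = I*(Δ, w)^n` for all `n > 0`."

## What is here

Weights `w : Sym2 σ → ℕ` on the edges of `G`; the weighted cover ideal in the form of Lemma 4.1,
`I_w = ⋂_{u ∼ v} (x_u, x_v)^{w_{uv}}`, and `I_w^{(k)} = ⋂_{u ∼ v} (x_u, x_v)^{k w_{uv}}`; any field.

* § 1 the two rounding inequalities of the proof (with `⌈a/k⌉ = ⌊a/k⌋ + [k ∤ a]`).
* § 2 the monomial criterion for `I_w^{(k)}` (vertex covers of `(G, w)` of order `k`), term property,
  `I_w^k ⊆ I_w^{(k)}`.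
* § 3 **Theorem 5.4: for bipartite `G`, every vertex cover of `(G, w)` of order `k` splits off one
  of order `1` by the printed rounding, hence `I_w^{(k)} = I_w^k` for all `k`.**

## References

* [HerzogHibiTrung2007] J. Herzog, T. Hibi, N. V. Trung, *Symbolic powers of monomial ideals and
  vertex cover algebras*, Adv. Math. 210 (2007) 304–322, §4, Lemma 4.1, Thm. 5.4.
-/

noncomputable section

open Finset MvPolynomial
open Literature.RingTheory.MvPolynomial

universe u

namespace Literature.AlgebraicGeometry.ProjectiveSpace

/-! ### § 1 The rounding inequalities -/

/-- **"`⌈a/k⌉ + ⌊b/k⌋ ≥ N` whenever `a + b ≥ k N`"** (`k ≥ 1`; `⌈a/k⌉ = ⌊a/k⌋ + [k ∤ a]`).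
[cite: HerzogHibiTrung2007, Thm. 5.4 (proof, first claim)] -/
theorem ceilDiv_add_div_ge {a b k N : ℕ} (hk : 1 ≤ k) (h : k * N ≤ a + b) :
    N ≤ a / k + (if a % k = 0 then 0 else 1) + b / k := by
  have ha := Nat.div_add_mod a k
  have hb := Nat.div_add_mod b k
  have hra := Nat.mod_lt a (by omega : 0 < k)
  have hrb := Nat.mod_lt b (by omega : 0 < k)
  by_contra hlt
  push Not at hlt
  split_ifs at hlt with hr
  · have h1 : k * (a / k + b / k + 1) ≤ k * N := Nat.mul_le_mul_left k (by omega)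
    rw [mul_add, mul_add, mul_one] at h1
    omega
  · have h1 : k * (a / k + b / k + 2) ≤ k * N := Nat.mul_le_mul_left k (by omega)
    rw [mul_add, mul_add] at h1
    omega

/-- `⌈a/k⌉ ≤ a` for `k ≥ 1`. [cite: HerzogHibiTrung2007, Thm. 5.4 (proof, "`c = a − b ∈ ℕ^n`")] -/
theorem ceilDiv_le_self {a k : ℕ} (hk : 1 ≤ k) : a / k + (if a % k = 0 then 0 else 1) ≤ a := by
  have ha := Nat.div_add_mod a k
  have h1 : 1 * (a / k) ≤ k * (a / k) := Nat.mul_le_mul_right _ hk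
  split_ifs <;> omega

/-- **"`(a − ⌈a/k⌉) + (b − ⌊b/k⌋) ≥ (k − 1) N` whenever `a + b ≥ k N`."**
[cite: HerzogHibiTrung2007, Thm. 5.4 (proof, second claim)] -/
theorem sub_ceilDiv_add_sub_div_ge {a b k N : ℕ} (hk : 1 ≤ k) (h : k * N ≤ a + b) :
    (k - 1) * N ≤ (a - (a / k + if a % k = 0 then 0 else 1)) + (b - b / k) := by
  have ha := Nat.div_add_mod a k
  have hb := Nat.div_add_mod b k
  have hra := Nat.mod_lt a (by omega : 0 < k)
  have hrb := Nat.mod_lt b (by omega : 0 < k)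
  have hca := ceilDiv_le_self (a := a) hk
  have hqb : b / k ≤ b := by
    have h1 : 1 * (b / k) ≤ k * (b / k) := Nat.mul_le_mul_right _ hk
    omega
  rw [Nat.sub_one_mul]
  by_cases ht : N ≤ a / k + b / k
  · -- `t ≥ N`: `(k − 1) t ≥ (k − 1) N`
    have h1 : (k - 1) * N ≤ (k - 1) * (a / k + b / k) := Nat.mul_le_mul_left _ ht
    rw [Nat.sub_one_mul, Nat.sub_one_mul, mul_add] at h1
    split_ifs at hca ⊢ <;> omega
  · split_ifs at hca ⊢ <;> omega

/-! ### § 2 `I_w^{(k)} = ⋂_{u ∼ v} (x_u, x_v)^{k w_{uv}}`: vertex covers of `(G, w)` of order `k` -/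

variable {σ : Type*} [Fintype σ] [DecidableEq σ] (G : SimpleGraph σ) (w : Sym2 σ → ℕ)
variable {k : Type u} [Field k]

omit [Fintype σ] in
/-- **Lemma 4.1 for `(G, w)`: `x^a ∈ ⋂_{u ∼ v} (x_u, x_v)^{n w_{uv}}` iff `a_u + a_v ≥ n w_{uv}` for every
edge.** [cite: HerzogHibiTrung2007, Lemma 4.1 and §4] -/
theorem monomial_mem_weightedSymbolic_iff (n : ℕ) (a : σ →₀ ℕ) :
    (monomial a (1 : k) : MvPolynomial σ k) ∈ (⨅ p ∈ {p : σ × σ | G.Adj p.1 p.2},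
        (Ideal.span ({X p.1, X p.2} : Set (MvPolynomial σ k))) ^ (n * w s(p.1, p.2))) ↔
      ∀ u v, G.Adj u v → n * w s(u, v) ≤ a u + a v := by
  simp only [Submodule.mem_iInf, Set.mem_setOf_eq]
  constructor
  · intro h u v huv
    exact (monomial_mem_span_pair_pow_iff (G.ne_of_adj huv) _ a).mp (h (u, v) huv)
  · intro h p hp
    exact (monomial_mem_span_pair_pow_iff (G.ne_of_adj hp) _ a).mpr (h _ _ hp)

omit [Fintype σ] in
/-- `I_w^{(n)}` is a monomial ideal. [cite: HerzogHibiTrung2007, Lemma 4.1] -/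
theorem monomial_mem_weightedSymbolic_of_mem_support (n : ℕ) :
    ∀ g ∈ (⨅ p ∈ {p : σ × σ | G.Adj p.1 p.2},
        (Ideal.span ({X p.1, X p.2} : Set (MvPolynomial σ k))) ^ (n * w s(p.1, p.2))),
      ∀ a ∈ g.support, (monomial a (1 : k) : MvPolynomial σ k) ∈ (⨅ p ∈ {p : σ × σ | G.Adj p.1 p.2},
        (Ideal.span ({X p.1, X p.2} : Set (MvPolynomial σ k))) ^ (n * w s(p.1, p.2))) := by
  intro g hg a ha
  simp only [Submodule.mem_iInf, Set.mem_setOf_eq] at hg ⊢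
  intro p hp
  have h := hg p hp
  rw [span_pair_X_eq_span_image, ← Finset.coe_pair] at h ⊢
  exact monomial_mem_span_X_image_pow_of_mem_support _ _ _ h a ha

omit [Fintype σ] [DecidableEq σ] in
/-- `I_w = I_w^{(1)}`. [cite: HerzogHibiTrung2007, §4] -/
theorem weightedCoverIdeal_eq_symbolic_one :
    (⨅ p ∈ {p : σ × σ | G.Adj p.1 p.2},
        (Ideal.span ({X p.1, X p.2} : Set (MvPolynomial σ k))) ^ (w s(p.1, p.2))) =
      ⨅ p ∈ {p : σ × σ | G.Adj p.1 p.2},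
        (Ideal.span ({X p.1, X p.2} : Set (MvPolynomial σ k))) ^ (1 * w s(p.1, p.2)) := by
  simp_rw [one_mul]

omit [Fintype σ] [DecidableEq σ] in
/-- **`I_w^n ⊆ I_w^{(n)}`.** [cite: HerzogHibiTrung2007, §4 (ordinary vs symbolic powers)] -/
theorem weightedCoverIdeal_pow_le_symbolic (n : ℕ) :
    (⨅ p ∈ {p : σ × σ | G.Adj p.1 p.2},
        (Ideal.span ({X p.1, X p.2} : Set (MvPolynomial σ k))) ^ (w s(p.1, p.2))) ^ n ≤
      ⨅ p ∈ {p : σ × σ | G.Adj p.1 p.2},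
        (Ideal.span ({X p.1, X p.2} : Set (MvPolynomial σ k))) ^ (n * w s(p.1, p.2)) := by
  refine le_iInf fun p => le_iInf fun hp => ?_
  rw [mul_comm, pow_mul]
  exact Ideal.pow_right_mono (iInf₂_le p hp) n

/-! ### § 3 Theorem 5.4 -/

omit [DecidableEq σ] in
/-- **Theorem 5.4, the combinatorial statement: for bipartite `G`, a vertex cover `a` of `(G, w)` of
order `n ≥ 1` is `b + (a − b)` with `b ≤ a` of order `1` and `a − b` of order `n − 1`** (the printed
`b = ⌈a/n⌉` on one colour class, `⌊a/n⌋` on the other). [cite: HerzogHibiTrung2007, Thm. 5.4 (proof)] -/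
theorem exists_weighted_one_cover_le (hc : G.Colorable 2) {n : ℕ} (hn : 1 ≤ n) {a : σ →₀ ℕ}
    (ha : ∀ u v, G.Adj u v → n * w s(u, v) ≤ a u + a v) :
    ∃ b : σ →₀ ℕ, b ≤ a ∧ (∀ u v, G.Adj u v → w s(u, v) ≤ b u + b v) ∧
      ∀ u v, G.Adj u v → (n - 1) * w s(u, v) ≤ (a - b) u + (a - b) v := by
  obtain ⟨C⟩ := hc
  let b : σ →₀ ℕ := Finsupp.equivFunOnFinite.symm fun i =>
    if C i = 0 then a i / n + (if a i % n = 0 then 0 else 1) else a i / n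
  have hb : ∀ i, b i = if C i = 0 then a i / n + (if a i % n = 0 then 0 else 1) else a i / n :=
    fun i => by simp only [b, Finsupp.coe_equivFunOnFinite_symm]
  have hble : b ≤ a := fun i => by
    rw [hb]
    by_cases hC : C i = 0
    · rw [if_pos hC]
      exact ceilDiv_le_self hn
    · rw [if_neg hC]
      exact Nat.div_le_self _ _
  -- for an edge, one end has colour `0` and the other not
  have key : ∀ u v, G.Adj u v → C u = 0 →
      w s(u, v) ≤ b u + b v ∧ (n - 1) * w s(u, v) ≤ (a - b) u + (a - b) v := by
    intro u v huv hCu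
    have hCv : C v ≠ 0 := fun h => C.valid huv (hCu.trans h.symm)
    rw [Finsupp.tsub_apply, Finsupp.tsub_apply, hb, hb, if_pos hCu, if_neg hCv]
    exact ⟨ceilDiv_add_div_ge hn (ha u v huv), sub_ceilDiv_add_sub_div_ge hn (ha u v huv)⟩
  have fin2 : ∀ x y : Fin 2, x ≠ y → x ≠ 0 → y = 0 := by decide
  refine ⟨b, hble, fun u v huv => ?_, fun u v huv => ?_⟩
  · by_cases hCu : C u = 0
    · exact (key u v huv hCu).1
    · have := (key v u huv.symm (fin2 _ _ (C.valid huv) hCu)).1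
      rwa [Sym2.eq_swap, add_comm] at this
  · by_cases hCu : C u = 0
    · exact (key u v huv hCu).2
    · have := (key v u huv.symm (fin2 _ _ (C.valid huv) hCu)).2
      rwa [Sym2.eq_swap, add_comm] at this

/-- **Theorem 5.4 (monomial form): for bipartite `G`, `x^a ∈ I_w^n` for every vertex cover `a` of
`(G, w)` of order `n`.** [cite: HerzogHibiTrung2007, Thm. 5.4] -/
theorem monomial_mem_weightedCoverIdeal_pow_of_cover (hc : G.Colorable 2) :
    ∀ (n : ℕ) (a : σ →₀ ℕ), (∀ u v, G.Adj u v → n * w s(u, v) ≤ a u + a v) →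
      (monomial a (1 : k) : MvPolynomial σ k) ∈ (⨅ p ∈ {p : σ × σ | G.Adj p.1 p.2},
        (Ideal.span ({X p.1, X p.2} : Set (MvPolynomial σ k))) ^ (w s(p.1, p.2))) ^ n := by
  intro n
  induction n with
  | zero =>
    intro a _
    rw [pow_zero, Ideal.one_eq_top]
    exact Submodule.mem_top
  | succ n ih =>
    intro a ha
    obtain ⟨b, hble, hb1, hrest⟩ := exists_weighted_one_cover_le G w hc (Nat.succ_pos n) ha
    rw [Nat.succ_sub_one] at hrest
    have hsplit : (monomial a (1 : k) : MvPolynomial σ k) = monomial (a - b) (1 : k) * monomial b (1 : k) := by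
      rw [monomial_mul, mul_one, tsub_add_cancel_of_le hble]
    rw [hsplit, pow_succ]
    refine Ideal.mul_mem_mul (ih _ hrest) ?_
    rw [weightedCoverIdeal_eq_symbolic_one, monomial_mem_weightedSymbolic_iff]
    simpa only [one_mul] using hb1

/-- **Theorem 5.4 (Herzog–Hibi–Trung): for a bipartite graph `G` with arbitrary edge weights `w`,
`I_w^{(n)} = I_w^n` for all `n`, where `I_w = ⋂_{u ∼ v} (x_u, x_v)^{w_{uv}}` — the vertex cover
algebra `A(G, w)` is standard graded.** [cite: HerzogHibiTrung2007, Thm. 5.4 and Lemma 4.1] -/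
theorem weightedSymbolic_eq_pow_of_colorable_two (hc : G.Colorable 2) (n : ℕ) :
    (⨅ p ∈ {p : σ × σ | G.Adj p.1 p.2},
        (Ideal.span ({X p.1, X p.2} : Set (MvPolynomial σ k))) ^ (n * w s(p.1, p.2))) =
      (⨅ p ∈ {p : σ × σ | G.Adj p.1 p.2},
        (Ideal.span ({X p.1, X p.2} : Set (MvPolynomial σ k))) ^ (w s(p.1, p.2))) ^ n := by
  refine le_antisymm ?_ (weightedCoverIdeal_pow_le_symbolic G w n)
  intro f hf
  rw [f.as_sum]
  refine Ideal.sum_mem _ fun a haf => ?_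
  have hcov := (monomial_mem_weightedSymbolic_iff G w n a).mp
    (monomial_mem_weightedSymbolic_of_mem_support G w n f hf a haf)
  have h1 : monomial a (f.coeff a) = C (f.coeff a) * monomial a (1 : k) := by
    rw [C_mul_monomial, mul_one]
  rw [h1]
  exact Ideal.mul_mem_left _ _ (monomial_mem_weightedCoverIdeal_pow_of_cover G w hc n a hcov)

/-- The weight `w ≡ 1` recovers Theorem 5.1 (b) "if" (gen31-#15): `J(G)^{(n)} = (⋂ (x_u, x_v))^n`.
[cite: HerzogHibiTrung2007, Thm. 5.4 and Thm. 5.1 (b)] -/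
theorem symbolicCoverIdeal_eq_iInf_pow_of_colorable_two (hc : G.Colorable 2) (n : ℕ) :
    (⨅ p ∈ {p : σ × σ | G.Adj p.1 p.2}, (Ideal.span ({X p.1, X p.2} : Set (MvPolynomial σ k))) ^ n) =
      (⨅ p ∈ {p : σ × σ | G.Adj p.1 p.2}, Ideal.span ({X p.1, X p.2} : Set (MvPolynomial σ k))) ^ n := by
  have h := weightedSymbolic_eq_pow_of_colorable_two G (fun _ => 1) (k := k) hc n
  simp_rw [mul_one, pow_one] at h
  exact h

end Literature.AlgebraicGeometry.ProjectiveSpace
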